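import Mathlib
import HarnessLib
import Summits.NavierStokesRegularity.NavierStokesRegularity.Theorems.LocalSineTubeDoorLocalPointZoomGradSlices
import Summits.NavierStokesRegularity.NavierStokesRegularity.Theorems.LocalSineTubeDoorWindowFatou
import Summits.NavierStokesRegularity.NavierStokesRegularity.Theorems.LocalSineTubeDoorLocalPointZoomHessSlices
import Summits.NavierStokesRegularity.NavierStokesRegularity.Theorems.LocalSineTubeDoorWindowFatouSecondOrder

/-!
# The generic one-window door templates with the HONEST scaling hypothesis (for scalars of MIXED homogeneity)

Cell ns-regularity-ideate, seat p6 (route-directed support for nsreg-p1's door family; anchor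
`--supports stmt-NavierStokesRegularity-20017`).  The templates `…LocalSineTubeDoorGenericDoor.genericDoor_of_profileWindowRigidity`
(p441820) and `…GenericDoorSecondOrder.genericDoor2_of_profileWindowRigidity` (p445508) ask the window scalar's zero set to be
invariant under INDEPENDENT positive rescalings of each argument (`F(ax, bA) = 0 ↔ F(x, A) = 0`, resp. `(a, b, c)`).  The
zoom only ever produces the ONE-PARAMETER family of scalings `(a, b, c) = (σν, σ²ν, σ³ν)` (`σ = √(−s)/√ν`; see
`…WindowFatou.windowFatou_firstOrder`, `…WindowFatouSecondOrder.windowFatou_secondOrder`), so the honest hypothesis is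
invariance under THAT family — which scalars of MIXED homogeneity satisfy, e.g. the curl of the Lamb vector
`F(x, A, B) = ‖A (curlCLM A) − Σⱼ eⱼ × B[x, eⱼ]‖` with `F(ax, bA, cB) = ‖b²·P − ac·Q‖` (`b² = ac` on the family; the
door `…LocalLambTubeDoorCurlLambTarget.localTubeDoorCurlLamb` had to be assembled by hand for this reason).  This file
records both templates with the honest hypothesis, so that future mixed doors are one-liners again:

* `genericDoor_of_profileWindowRigidity_scaling` — first order, hypothesis
  `∀ σ ν > 0, F((σν)•x, (σ²ν)•A) = 0 ↔ F(x, A) = 0`;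
* `genericDoor2_of_profileWindowRigidity_scaling` — second order, hypothesis
  `∀ σ ν > 0, F((σν)•x, (σ²ν)•A, (σ³ν)•B) = 0 ↔ F(x, A, B) = 0`.

WHAT THIS IS NOT: not a claim about Navier–Stokes regularity; the door TEMPLATES (conditional on the profile crux given as a
hypothesis), bears_on LADDER-NS N0.
-/

noncomputable section

-- the summit and its single sub-problem share the name (CONVENTIONS §1), as in every Theorems file
set_option linter.dupNamespace false

namespace Summit.NavierStokesRegularity.NavierStokesRegularity.Theorems.LocalSineTubeDoorGenericDoorScaling

open MeasureTheory Set Function Filter Topology TopologicalSpace Metric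
open scoped RealInnerProductSpace InnerProductSpace NNReal ENNReal
open Literature.Analysis Literature.Analysis.FluidPDE
open Summit.NavierStokesRegularity.NavierStokesRegularity.Theorems.LocalSineTubeDoorLocalPointZoomGradSlices
open Summit.NavierStokesRegularity.NavierStokesRegularity.Theorems.LocalSineTubeDoorWindowFatou
open Summit.NavierStokesRegularity.NavierStokesRegularity.Theorems.LocalSineTubeDoorLocalPointZoomHessSlices
open Summit.NavierStokesRegularity.NavierStokesRegularity.Theorems.LocalSineTubeDoorWindowFatouSecondOrder

/-- **GENERIC FIRST-ORDER ONE-WINDOW DOOR ⇐ ITS PROFILE WINDOW CRUX, honest scaling hypothesis.**  As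
`genericDoor_of_profileWindowRigidity`, but the zero set of `F` is only asked to be invariant under the zoom's own scalings
`(x, A) ↦ ((σν)•x, (σ²ν)•A)`, `σ, ν > 0`. -/
theorem genericDoor_of_profileWindowRigidity_scaling
    (F : EuclideanSpace ℝ (Fin 3) → (EuclideanSpace ℝ (Fin 3) →L[ℝ] EuclideanSpace ℝ (Fin 3)) → ℝ)
    (hF : Continuous fun q : EuclideanSpace ℝ (Fin 3) × (EuclideanSpace ℝ (Fin 3) →L[ℝ] EuclideanSpace ℝ (Fin 3)) =>
      F q.1 q.2)
    (hscale : ∀ (σ ν : ℝ), 0 < σ → 0 < ν → ∀ (x : EuclideanSpace ℝ (Fin 3))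
      (A : EuclideanSpace ℝ (Fin 3) →L[ℝ] EuclideanSpace ℝ (Fin 3)), F ((σ * ν) • x) ((σ ^ 2 * ν) • A) = 0 ↔ F x A = 0)
    (hcrux : ∀ (C : ℝ) (v : ℝ → EuclideanSpace ℝ (Fin 3) → EuclideanSpace ℝ (Fin 3)),
      Literature.Analysis.FluidPDE.HasTypeITimeDecay C v →
      ContinuousOn (Function.uncurry v) (Set.Iio (0 : ℝ) ×ˢ Set.univ) →
      (∀ s t : ℝ, s < t → t < 0 → ∀ x, v t x =
        Literature.Analysis.UnboundedOperators.heatExtension (v s) (t - s) x -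
          Literature.Analysis.FluidPDE.oseenDuhamel 1 s v v t x) →
      (∀ t < 0, Literature.Analysis.FluidPDE.VectorCalculus.IsDivFree (v t)) →
      (∀ s < 0, ∃ U : Set (EuclideanSpace ℝ (Fin 3)), IsOpen U ∧ U.Nonempty ∧
        ∀ z ∈ U, F (v s z) (fderiv ℝ (v s) z) = 0) →
      ¬ Literature.Analysis.FluidPDE.IsBackwardSingularPoint v 0) :
    ∀ (ν T : ℝ), 0 < ν → 0 < T → ∀ (u : ℝ → EuclideanSpace ℝ (Fin 3) → EuclideanSpace ℝ (Fin 3))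
      (p : ℝ → EuclideanSpace ℝ (Fin 3) → ℝ),
    Literature.Analysis.FluidPDE.IsClassicalNSSolutionOn (Set.Ico 0 T) ν 0 u p →
    Literature.Analysis.FluidPDE.IsLerayHopfOn T ν 0 (u 0) u →
    Literature.Analysis.FluidPDE.HasRapidSpatialDecay (u 0) →
    ∀ (x₀ : EuclideanSpace ℝ (Fin 3)) (ρ M : ℝ), 0 < ρ →
    (∀ t ∈ Set.Ico 0 T, T - ρ ^ 2 < t → ∀ x ∈ Metric.ball x₀ ρ, ‖u t x‖ * Real.sqrt (ν * (T - t)) ≤ M) →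
    ∀ (U : Set (EuclideanSpace ℝ (Fin 3))), IsOpen U → U.Nonempty →
    Filter.Tendsto (fun t => ∫⁻ y in U, ENNReal.ofReal
      |F (Real.sqrt (T - t) • u t (x₀ + Real.sqrt (T - t) • y))
        (Real.sqrt (T - t) ^ 2 • fderiv ℝ (u t) (x₀ + Real.sqrt (T - t) • y))|)
      (nhdsWithin T (Set.Iio T)) (nhds 0) →
    Literature.Analysis.FluidPDE.IsBackwardBoundedAt u T x₀ := by
  intro ν T hν hT u p hcl hLH hdec x₀ ρ M hρ hM U hU hUne hfade
  by_contra hnot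
  obtain ⟨C, v, lam, hlam, hlam0, ⟨hrate, hcont, hmild, hdiv⟩, hsing, hconv⟩ :=
    localPointZoomVelGradSlices ν T hν hT u p hcl hLH hdec x₀ ρ M hρ hM hnot
  refine hcrux C v hrate hcont hmild hdiv (fun s hs => ?_) hsing
  have hns : 0 < -s := neg_pos.2 hs
  set σ : ℝ := Real.sqrt (-s) / Real.sqrt ν with hσ
  have hσpos : 0 < σ := div_pos (Real.sqrt_pos.2 hns) (Real.sqrt_pos.2 hν)
  refine ⟨(fun z => σ⁻¹ • z) ⁻¹' U, hU.preimage (continuous_const_smul σ⁻¹), ?_, fun z hz => ?_⟩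
  · obtain ⟨u₀, hu₀⟩ := hUne
    refine ⟨σ • u₀, ?_⟩
    show σ⁻¹ • (σ • u₀) ∈ U
    rwa [smul_smul, inv_mul_cancel₀ hσpos.ne', one_smul]
  · have hy : σ⁻¹ • z ∈ U := hz
    have key := windowFatou_firstOrder hν hT hcl hlam hlam0 hrate hcont hmild hconv F hF hU hfade hs hy
    have hzz : σ • (σ⁻¹ • z) = z := by rw [smul_smul, mul_inv_cancel₀ hσpos.ne', one_smul]
    rw [← hσ, hzz] at key
    exact (hscale σ ν hσpos hν (v s z) (fderiv ℝ (v s) z)).1 key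

/-- **GENERIC SECOND-ORDER ONE-WINDOW DOOR ⇐ ITS PROFILE WINDOW CRUX, honest scaling hypothesis.**  As
`genericDoor2_of_profileWindowRigidity`, but the zero set of `F` is only asked to be invariant under the zoom's own scalings
`(x, A, B) ↦ ((σν)•x, (σ²ν)•A, (σ³ν)•B)`, `σ, ν > 0` — the form satisfied by scalars of mixed homogeneity such as
`‖A (curlCLM A) − Σⱼ eⱼ × B[x, eⱼ]‖`. -/
theorem genericDoor2_of_profileWindowRigidity_scaling
    (F : EuclideanSpace ℝ (Fin 3) → (EuclideanSpace ℝ (Fin 3) →L[ℝ] EuclideanSpace ℝ (Fin 3)) →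
      ContinuousMultilinearMap ℝ (fun _ : Fin 2 => EuclideanSpace ℝ (Fin 3)) (EuclideanSpace ℝ (Fin 3)) → ℝ)
    (hF : Continuous fun q : EuclideanSpace ℝ (Fin 3) × (EuclideanSpace ℝ (Fin 3) →L[ℝ] EuclideanSpace ℝ (Fin 3)) ×
      ContinuousMultilinearMap ℝ (fun _ : Fin 2 => EuclideanSpace ℝ (Fin 3)) (EuclideanSpace ℝ (Fin 3)) =>
      F q.1 q.2.1 q.2.2)
    (hscale : ∀ (σ ν : ℝ), 0 < σ → 0 < ν → ∀ (x : EuclideanSpace ℝ (Fin 3))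
      (A : EuclideanSpace ℝ (Fin 3) →L[ℝ] EuclideanSpace ℝ (Fin 3))
      (B : ContinuousMultilinearMap ℝ (fun _ : Fin 2 => EuclideanSpace ℝ (Fin 3)) (EuclideanSpace ℝ (Fin 3))),
      F ((σ * ν) • x) ((σ ^ 2 * ν) • A) ((σ ^ 3 * ν) • B) = 0 ↔ F x A B = 0)
    (hcrux : ∀ (C : ℝ) (v : ℝ → EuclideanSpace ℝ (Fin 3) → EuclideanSpace ℝ (Fin 3)),
      Literature.Analysis.FluidPDE.HasTypeITimeDecay C v →
      ContinuousOn (Function.uncurry v) (Set.Iio (0 : ℝ) ×ˢ Set.univ) →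
      (∀ s t : ℝ, s < t → t < 0 → ∀ x, v t x =
        Literature.Analysis.UnboundedOperators.heatExtension (v s) (t - s) x -
          Literature.Analysis.FluidPDE.oseenDuhamel 1 s v v t x) →
      (∀ t < 0, Literature.Analysis.FluidPDE.VectorCalculus.IsDivFree (v t)) →
      (∀ s < 0, ∃ U : Set (EuclideanSpace ℝ (Fin 3)), IsOpen U ∧ U.Nonempty ∧
        ∀ z ∈ U, F (v s z) (fderiv ℝ (v s) z) (iteratedFDeriv ℝ 2 (v s) z) = 0) →
      ¬ Literature.Analysis.FluidPDE.IsBackwardSingularPoint v 0) :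
    ∀ (ν T : ℝ), 0 < ν → 0 < T → ∀ (u : ℝ → EuclideanSpace ℝ (Fin 3) → EuclideanSpace ℝ (Fin 3))
      (p : ℝ → EuclideanSpace ℝ (Fin 3) → ℝ),
    Literature.Analysis.FluidPDE.IsClassicalNSSolutionOn (Set.Ico 0 T) ν 0 u p →
    Literature.Analysis.FluidPDE.IsLerayHopfOn T ν 0 (u 0) u →
    Literature.Analysis.FluidPDE.HasRapidSpatialDecay (u 0) →
    ∀ (x₀ : EuclideanSpace ℝ (Fin 3)) (ρ M : ℝ), 0 < ρ →
    (∀ t ∈ Set.Ico 0 T, T - ρ ^ 2 < t → ∀ x ∈ Metric.ball x₀ ρ, ‖u t x‖ * Real.sqrt (ν * (T - t)) ≤ M) →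
    ∀ (U : Set (EuclideanSpace ℝ (Fin 3))), IsOpen U → U.Nonempty →
    Filter.Tendsto (fun t => ∫⁻ y in U, ENNReal.ofReal
      |F (Real.sqrt (T - t) • u t (x₀ + Real.sqrt (T - t) • y))
        (Real.sqrt (T - t) ^ 2 • fderiv ℝ (u t) (x₀ + Real.sqrt (T - t) • y))
        (Real.sqrt (T - t) ^ 3 • iteratedFDeriv ℝ 2 (u t) (x₀ + Real.sqrt (T - t) • y))|)
      (nhdsWithin T (Set.Iio T)) (nhds 0) →
    Literature.Analysis.FluidPDE.IsBackwardBoundedAt u T x₀ := by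
  intro ν T hν hT u p hcl hLH hdec x₀ ρ M hρ hM U hU hUne hfade
  by_contra hnot
  obtain ⟨C, v, lam, hlam, hlam0, ⟨hrate, hcont, hmild, hdiv⟩, hsing, hconv⟩ :=
    localPointZoomVelGradHessSlices ν T hν hT u p hcl hLH hdec x₀ ρ M hρ hM hnot
  refine hcrux C v hrate hcont hmild hdiv (fun s hs => ?_) hsing
  have hns : 0 < -s := neg_pos.2 hs
  set σ : ℝ := Real.sqrt (-s) / Real.sqrt ν with hσ
  have hσpos : 0 < σ := div_pos (Real.sqrt_pos.2 hns) (Real.sqrt_pos.2 hν)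
  refine ⟨(fun z => σ⁻¹ • z) ⁻¹' U, hU.preimage (continuous_const_smul σ⁻¹), ?_, fun z hz => ?_⟩
  · obtain ⟨u₀, hu₀⟩ := hUne
    refine ⟨σ • u₀, ?_⟩
    show σ⁻¹ • (σ • u₀) ∈ U
    rwa [smul_smul, inv_mul_cancel₀ hσpos.ne', one_smul]
  · have hy : σ⁻¹ • z ∈ U := hz
    have key := windowFatou_secondOrder hν hT hcl hlam hlam0 hrate hcont hmild hconv F hF hU hfade hs hy
    have hzz : σ • (σ⁻¹ • z) = z := by rw [smul_smul, mul_inv_cancel₀ hσpos.ne', one_smul]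
    rw [← hσ, hzz] at key
    exact (hscale σ ν hσpos hν (v s z) (fderiv ℝ (v s) z) (iteratedFDeriv ℝ 2 (v s) z)).1 key

end Summit.NavierStokesRegularity.NavierStokesRegularity.Theorems.LocalSineTubeDoorGenericDoorScaling

end
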